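import Summits.FinalStateConjecture.FinalStateConjecture.Theses.LaminatedThreshold
import Summits.FinalStateConjecture.FinalStateConjecture.Theorems.LaminatedThresholdAssemblyFrame

/-!
# Crux `LaminatedThreshold` (stmt-FinalStateConjecture-16893) — ONE-SIDED local exits already refute it

Negative support lemma for the crux of the REFUTATION route `LaminatedThreshold` (refuter, cdisprove
cycle 1). The landed kill criterion `not_laminatedThreshold_of_localExits`
(`LaminatedThresholdLaminatedThresholdCore`) asks, at every admissible exceptional datum, for a local
family whose members with `0 < ‖c‖ < ε` are ALL good. The crux dies from strictly less:
`not_laminatedThreshold_of_halfLocalExits` — at every admissible exceptional datum `d⋆`, ONE local family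
`F` (jointly smooth, `F 0 = d⋆`, admissible members, agreeing with `d⋆` off one compact set) with a
ONE-SIDED punctured window of good members, `F (t • v)` good for `t ∈ (0, ε)` along ONE direction
`v ≠ 0`. This is the contrapositive, stated against the crux decl BY NAME, of the landed
`exceptional_accumulate_of_laminatedThreshold` (at the witness datum exceptional members accumulate at
`0` along every ray of every local family).

Why it matters for the line: a datum on the boundary of the DISPERSIVE region along some local curve
whose sub-critical side is clean (every numerically resolved vacuum collapse threshold is of this kind:
Baumgarte et al., PRL 131 (2023) 181401 = arXiv:2305.17171, p. 3, sub-critical Kretschmann maxima follow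
an approximate power law in `|A − A⋆|` along the centred Brill family, three codes) can never witness the
crux; the comb of exceptional leaves has to be two-sided, i.e. the sub-critical branch must be captured
by a NAKED secondary attractor as well. "Good" is the summit's per-datum property
`(∃ MGHD) ∧ ∀ MGHD, SettlesT2` (`ClusterCompleteness.SettlesT2`, `Iff.rfl` with the route file's block).
Pure logic over landed modules; no definitions, no named facts.
-/

-- every `Summit.FinalStateConjecture.FinalStateConjecture.…` name repeats the summit = sub-problem segment (D-0017 layout)
set_option linter.dupNamespace false

noncomputable section

open Set Filter Metric
open scoped Manifold ContDiff Topology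

namespace Summit.FinalStateConjecture.FinalStateConjecture.Theorems.LaminatedThreshold.Negative

open Literature.Geometry.Lorentzian
open Summit.FinalStateConjecture.FinalStateConjecture.Theorems.ClusterCompleteness (SettlesT2)

/-- **Half exits kill the crux.** If at every admissible exceptional datum `d⋆` (on every admissible
`3`-manifold `X`) some local family `F` through `d⋆` — jointly smooth, `F 0 = d⋆`, admissible members,
agreeing with `d⋆` off one compact set — has a one-sided punctured window of GOOD members,
`F (t • v)` good for all `t ∈ (0, ε)` for one direction `v ≠ 0` and one `ε > 0`, then the crux
`LaminatedThreshold` is false: at its witness datum, `exceptional_accumulate_of_laminatedThreshold`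
produces an exceptional member `F (t • v)` with `t ∈ (0, ε)`. [folklore] -/
theorem not_laminatedThreshold_of_halfLocalExits
    (h : ∀ (X : Type) [TopologicalSpace X] [ChartedSpace E3 X] [IsManifold (𝓡 3) ∞ X]
      [T2Space X] [SecondCountableTopology X] [ConnectedSpace X],
      ∀ dstar ∈ admissibleVacuumData X,
        ¬ ((∃ 𝒟 : VacuumCauchyDevelopment dstar, 𝒟.IsMaximal) ∧
            ∀ 𝒟 : VacuumCauchyDevelopment dstar, 𝒟.IsMaximal → SettlesT2 𝒟) →
          ∃ F : EuclideanSpace ℝ (Fin 1) → InitialDataSet (𝓡 3) X,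
            InitialDataSet.IsSmoothDataFamily 1 F ∧ F 0 = dstar ∧
              (∀ c, F c ∈ admissibleVacuumData X) ∧
                (∃ C : Set X, IsCompact C ∧
                  ∀ c, ∀ x ∉ C, (F c).h.inner x = dstar.h.inner x ∧ (F c).k x = dstar.k x) ∧
                  ∃ v : EuclideanSpace ℝ (Fin 1), v ≠ 0 ∧ ∃ ε : ℝ, 0 < ε ∧ ∀ t ∈ Set.Ioo (0 : ℝ) ε,
                    ((∃ 𝒟 : VacuumCauchyDevelopment (F (t • v)), 𝒟.IsMaximal) ∧
                      ∀ 𝒟 : VacuumCauchyDevelopment (F (t • v)), 𝒟.IsMaximal → SettlesT2 𝒟)) :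
    ¬ Theses.LaminatedThreshold.LaminatedThreshold := by
  intro hLT
  obtain ⟨X, i₁, i₂, i₃, i₄, i₅, i₆, dstar, hadm, hbad, hacc⟩ :=
    exceptional_accumulate_of_laminatedThreshold hLT
  obtain ⟨F, hF, h0, hadmF, hC, v, hv, ε, hε, hgood⟩ := h X dstar hadm hbad
  obtain ⟨t, ht, hbadt⟩ := hacc F hF h0 hadmF hC v hv ε hε
  exact hbadt (hgood t ht)

end Summit.FinalStateConjecture.FinalStateConjecture.Theorems.LaminatedThreshold.Negative

end
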